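import Summits.CriticalPhenomena.Ising3DConformalLimit.Theses.SubPtolemyInterlacing
import Summits.CriticalPhenomena.Ising3DConformalLimit.Theorems.SubPtolemyInterlacingSubPtolemyFloorCertificates
import Summits.CriticalPhenomena.Ising3DConformalLimit.Theorems.SubPtolemyInterlacingSubPtolemyFloorSteinCovariance
import Summits.CriticalPhenomena.Ising3DConformalLimit.Theorems.SubPtolemyInterlacingSubPtolemyFloorPlusCauchySchwarz
import Summits.CriticalPhenomena.Ising3DConformalLimit.Theorems.SubPtolemyInterlacingSubPtolemyFloorSteinDecorrelation
import Literature.Probability.LatticeModels.CriticalBlockMoments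
import Literature.Probability.LatticeModels.FreeStateLimit
import HarnessLib

/-!
# Line `Sketch` (= crux idea `stein-cramer-rao-dual-witness`, r2 k4) — skeleton for the crux
`SubPtolemyFloor` (stmt-CriticalPhenomena-15703), lead c4

Route decl: `Summit.CriticalPhenomena.Ising3DConformalLimit.Theses.SubPtolemyInterlacing.SubPtolemyFloor`
(`∃ a c, a < log₂(1+√2) ∧ 0 < c ∧ ∀ n ≥ 1, c n^{-a} ≤ ⟨σ₀σ_{ne₁}⟩⁺_{β_c(3)}`).

Notation (informal; everything below is UNFOLDED in tree vocabulary, the line posits no definition):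
`β = criticalBeta 3`, `⟨·⟩ = plusExpect 3 β 0` (the critical plus state), `G = criticalTwoPoint 3`,
`Λ_N = box 3 N`, `S_x σ = ∑ y ∈ (zdGraph 3).neighborFinset x, spinAt y σ`, `t_x = tanh(β S_x)`,
`g_x = σ_x − t_x` (the DLR score / Stein kernel), for a local functional `A` (reading the finite set
`K ∌ 0`) `A_x σ = A (fun y => σ (y + x))` (reads `K + x ∌ x`), the STEIN FIELD `Ψ^A_x = A_x g_x`, its
coupling `c_A = ⟨A (1 − t_0²)⟩`, block variance `V_A(N) = ⟨(Σ_{x∈Λ_N} Ψ^A_x)²⟩` and the pair sum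
`B(N) = Σ_{x,y∈Λ_N} G(y − x) = ⟨M_N²⟩`, `M_N = Σ_{x∈Λ_N} σ_x`.

STATUS (lead c4, wave 1 integrated): S1 `stub_steinCovariance` LANDED p148306
(`Theorems/SubPtolemyInterlacingSubPtolemyFloorSteinCovariance.lean`), S2 `stub_plusCauchySchwarz` LANDED
p149771 (`…PlusCauchySchwarz.lean`), S3 `stub_steinDecorrelation` LANDED p150553 (`…SteinDecorrelation.lean`);
toolkit `Literature.Probability.LatticeModels.PlusStateHeatBath` LANDED p146490. The three landed stubs are
IMPORTED below (their declarations removed from this file); the only remaining `sorry` is the engine E.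
Also LANDED: the certificate file `Theorems/…SubPtolemyFloorSteinCertificate.lean` (p151565: `cramerRaoFloor`,
`boxPairFloor_of_steinWitness`, `subPtolemyFloor_of_steinWitness` = E ⇒ crux BY NAME, registered certificate stub
`stub_cruxOfSteinWitness`, doubling branch, `steinWitness_false_of_two_lt` = b > 2 impossible) and the window /
obstruction file `Theorems/…SubPtolemyFloorSteinWindow.lean` (p151778 + p152006: `plusExpect_steinField_sq`,
`coupling_sq_le_plusExpect_sq_mul`, `stub_steinMajorantObstruction`, `stub_steinOffdiagCancellation`).
LINE VERDICT (lead c4, 2026-08-17): DEAD at E — see `Lines/Sketch_dead.md`: E ⇒ the dead residual E₁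
(χ_n ≥ c n^b, a₀ = 3 − b < 1.166) by the CR floor below, and the card's term-wise majorant producer cannot
certify E for any b > 0 (E is a cancellation / near-hyperuniformity statement).

Composition (all glue PROVED here; sorries only in `stub_*`):
* S1 `stub_steinCovariance`   : `⟨M_N · Σ_{x∈Λ_N} Ψ^A_x⟩ = |Λ_N| c_A` (heat-bath/DLR + translation invariance);
* S2 `stub_plusCauchySchwarz` : `⟨f g⟩² ≤ ⟨f²⟩⟨g²⟩` for local `f, g` in the plus state (any `d`, `β ≥ 0`);
* S3 `stub_steinDecorrelation`: `⟨Ψ^A_0 Ψ^B_z⟩ = 0` when `σ_0` is read by neither `A`, `B_z` nor `g_z`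
  (the card's Lemma 1/1′, min-rule form) — a tool for the ENGINE, not used in the composition;
* E  `stub_steinWitness` (ENGINE, lead): Stein witnesses with block variance `V_A(r) ≤ C |Λ_r| r^{-b} c_A²`,
  `b ∈ (3 − 3L/(2+L), 2]` (homogeneous form of the card's `SteinWitness b`; weaker than the card's);
* glue: `cramerRaoFloor` (S1+S2+`plusExpect_blockSpin_sq_eq_sum`: `(|Λ_N| c_A)² ≤ B(N) · V_A(N)`),
  `boxPairFloor_of_steinWitness` (`B(r) ≥ (1/C) r^{3+b}`), then the LANDED tree stubs
  `SubPtolemyFloorSketch.stub_susceptibilityFloorOfBoxPairFloor` (p129162) and certificate C1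
  `SubPtolemyFloorSketch.stub_cruxOfSusceptibilityFloor` (p129874) give `SubPtolemyFloor_of : SubPtolemyFloor`.
-/

noncomputable section

namespace Summit.CriticalPhenomena.Ising3DConformalLimit.SubPtolemyFloorStein

open scoped BigOperators Classical
open Finset MeasureTheory Literature.Probability.LatticeModels
open Summit.CriticalPhenomena.Ising3DConformalLimit.Theses.SubPtolemyInterlacing

/-! ### Registered stubs -/

/-- **E — ENGINE (lead c4).** Stein witnesses at every scale: for some `b ∈ (3 − 3L/(2+L), 2]`
(`L = log₂(1+√2)`, window `(1.834, 2]`) and `C > 0`, at every scale `r ≥ 1` there is a local functional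
`A` not reading `σ_0`, with positive coupling `c_A = ⟨A(1 − t_0²)⟩ > 0`, whose Stein field has block
variance `V_A(r) ≤ C |Λ_r| r^{-b} c_A²`. OPEN (the line's content; truth conjecturally `b = 2 − η = 1.964`). -/
theorem stub_steinWitness :
    ∃ b C : ℝ, 3 - 3 * Real.logb 2 (1 + Real.sqrt 2) / (2 + Real.logb 2 (1 + Real.sqrt 2)) < b ∧
      b ≤ 2 ∧ 0 < C ∧
      ∀ r : ℕ, 1 ≤ r → ∃ (K : Finset (Site 3)) (A : SpinConfig (Site 3) → ℝ),
        (0 : Site 3) ∉ K ∧ DependsOn A (↑K : Set (Site 3)) ∧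
        0 < plusExpect 3 (criticalBeta 3) 0 (fun σ => A σ *
            (1 - Real.tanh (criticalBeta 3 * ∑ y ∈ (zdGraph 3).neighborFinset 0, spinAt y σ) ^ 2)) ∧
        plusExpect 3 (criticalBeta 3) 0 (fun σ => (∑ x ∈ box 3 r, A (fun y => σ (y + x)) *
            (spinAt x σ - Real.tanh (criticalBeta 3 *
              ∑ y ∈ (zdGraph 3).neighborFinset x, spinAt y σ))) ^ 2) ≤
          C * (#(box 3 r) : ℝ) * (r : ℝ) ^ (-b) *
            plusExpect 3 (criticalBeta 3) 0 (fun σ => A σ *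
              (1 - Real.tanh (criticalBeta 3 *
                ∑ y ∈ (zdGraph 3).neighborFinset 0, spinAt y σ) ^ 2)) ^ 2 := by
  sorry

/- S1 `stub_steinCovariance`, S2 `stub_plusCauchySchwarz`, S3 `stub_steinDecorrelation`: LANDED (imported;
   see the STATUS block above for proposal ids and files). -/

/-! ### Glue: `DependsOn` bookkeeping for the block spin and the Stein sum -/

/-- A finite sum of functionals each depending on the spins in `D` depends on the spins in `D`. [folklore] -/
theorem dependsOn_finset_sum {ι : Type*} (s : Finset ι) {D : Set (Site 3)}
    {F : ι → SpinConfig (Site 3) → ℝ} (hF : ∀ i ∈ s, DependsOn (F i) D) :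
    DependsOn (fun σ => ∑ i ∈ s, F i σ) D :=
  fun _ _ h => Finset.sum_congr rfl fun i hi => hF i hi h

/-- The block spin `M_N` depends on the spins in `Λ_N`. [folklore] -/
theorem dependsOn_blockSpin (N : ℕ) :
    DependsOn (fun σ : SpinConfig (Site 3) => ∑ x ∈ box 3 N, spinAt x σ) (↑(box 3 N) : Set (Site 3)) :=
  dependsOn_finset_sum _ fun x hx _ _ h => by simp only [spinAt, h x (by simpa using hx)]

/-- The finite set of spins read by the Stein sum `Σ_{x∈Λ_N} Ψ^A_x`: the sites `x`, their
neighbours, and `K + x`, for `x ∈ Λ_N`. [folklore] -/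
def steinSupport (K : Finset (Site 3)) (N : ℕ) : Finset (Site 3) :=
  (box 3 N).biUnion fun x => insert x ((zdGraph 3).neighborFinset x ∪ K.image (· + x))

/-- The Stein sum depends on the spins in `steinSupport K N`. [folklore] -/
theorem dependsOn_steinSum (K : Finset (Site 3)) (A : SpinConfig (Site 3) → ℝ)
    (hA : DependsOn A (↑K : Set (Site 3))) (N : ℕ) :
    DependsOn (fun σ : SpinConfig (Site 3) => ∑ x ∈ box 3 N, A (fun y => σ (y + x)) *
        (spinAt x σ - Real.tanh (criticalBeta 3 * ∑ y ∈ (zdGraph 3).neighborFinset x, spinAt y σ)))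
      (↑(steinSupport K N) : Set (Site 3)) := by
  refine dependsOn_finset_sum _ fun x hx σ τ h => ?_
  have hmem : ∀ y, y ∈ insert x ((zdGraph 3).neighborFinset x ∪ K.image (· + x)) →
      y ∈ (↑(steinSupport K N) : Set (Site 3)) := fun y hy => by
    simp only [steinSupport, coe_biUnion, Set.mem_iUnion, mem_coe]
    exact ⟨x, hx, hy⟩
  have h1 : A (fun y => σ (y + x)) = A (fun y => τ (y + x)) :=
    hA fun y hy => h _ (hmem _ (mem_insert_of_mem (mem_union_right _ (mem_image_of_mem _ hy))))
  have h2 : spinAt x σ = spinAt x τ := by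
    simp only [spinAt, h x (hmem x (mem_insert_self _ _))]
  have h3 : ∑ y ∈ (zdGraph 3).neighborFinset x, spinAt y σ =
      ∑ y ∈ (zdGraph 3).neighborFinset x, spinAt y τ :=
    Finset.sum_congr rfl fun y hy => by
      simp only [spinAt, h y (hmem y (mem_insert_of_mem (mem_union_left _ hy)))]
  rw [h1, h2, h3]

/-! ### Glue: the Cramér–Rao floor and the transfer to the crux -/

/-- **Cramér–Rao floor with a Stein witness** (card Lemma 2): for a local `A` not reading `σ_0` and
every `N`, `(|Λ_N| c_A)² ≤ B(N) · V_A(N)` with `B(N) = Σ_{x,y∈Λ_N} G(y−x) = ⟨M_N²⟩`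
(S1, S2, `plusExpect_blockSpin_sq_eq_sum`, `criticalCorr_two_pair`). [folklore] -/
theorem cramerRaoFloor (K : Finset (Site 3)) (A : SpinConfig (Site 3) → ℝ) (hK : (0 : Site 3) ∉ K)
    (hA : DependsOn A (↑K : Set (Site 3))) (N : ℕ) :
    ((#(box 3 N) : ℝ) * plusExpect 3 (criticalBeta 3) 0 (fun σ => A σ *
        (1 - Real.tanh (criticalBeta 3 * ∑ y ∈ (zdGraph 3).neighborFinset 0, spinAt y σ) ^ 2))) ^ 2 ≤
      (∑ x ∈ box 3 N, ∑ y ∈ box 3 N, criticalTwoPoint 3 (y - x)) *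
        plusExpect 3 (criticalBeta 3) 0 (fun σ => (∑ x ∈ box 3 N, A (fun y => σ (y + x)) *
          (spinAt x σ - Real.tanh (criticalBeta 3 *
            ∑ y ∈ (zdGraph 3).neighborFinset x, spinAt y σ))) ^ 2) := by
  have h1 := stub_steinCovariance K A hK hA N
  have h2 := stub_plusCauchySchwarz 3 (criticalBeta 3) (criticalBeta_nonneg 3) (box 3 N)
    (steinSupport K N) _ _ (dependsOn_blockSpin N) (dependsOn_steinSum K A hA N)
  have h3 : plusExpect 3 (criticalBeta 3) 0 (fun σ => (∑ x ∈ box 3 N, spinAt x σ) ^ 2) =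
      ∑ x ∈ box 3 N, ∑ y ∈ box 3 N, criticalTwoPoint 3 (y - x) := by
    rw [plusExpect_blockSpin_sq_eq_sum]
    exact Finset.sum_congr rfl fun a _ => Finset.sum_congr rfl fun b _ => criticalCorr_two_pair a b
  rw [h1, h3] at h2
  exact h2

/-- `|Λ_r| = (2r+1)³ ≥ r³` as reals. [folklore] -/
theorem rpow_three_le_card_box (r : ℕ) : (r : ℝ) ^ (3 : ℝ) ≤ (#(box 3 r) : ℝ) := by
  rw [card_box, show (3 : ℝ) = ((3 : ℕ) : ℝ) by norm_num, Real.rpow_natCast]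
  push_cast
  have hr : (0 : ℝ) ≤ r := Nat.cast_nonneg r
  exact pow_le_pow_left₀ hr (show (r : ℝ) ≤ 2 * r + 1 by linarith) 3

/-- **Transfer, step 1: Stein witnesses ⇒ pair-sum floor.** From the engine's witnesses with exponent
`b` and the Cramér–Rao floor, `B(r) = Σ_{x,y∈Λ_r} G(y−x) ≥ C⁻¹ r^{3+b}` for all `r ≥ 1`. [folklore] -/
theorem boxPairFloor_of_steinWitness {b C : ℝ} (hC : 0 < C)
    (hW : ∀ r : ℕ, 1 ≤ r → ∃ (K : Finset (Site 3)) (A : SpinConfig (Site 3) → ℝ),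
        (0 : Site 3) ∉ K ∧ DependsOn A (↑K : Set (Site 3)) ∧
        0 < plusExpect 3 (criticalBeta 3) 0 (fun σ => A σ *
            (1 - Real.tanh (criticalBeta 3 * ∑ y ∈ (zdGraph 3).neighborFinset 0, spinAt y σ) ^ 2)) ∧
        plusExpect 3 (criticalBeta 3) 0 (fun σ => (∑ x ∈ box 3 r, A (fun y => σ (y + x)) *
            (spinAt x σ - Real.tanh (criticalBeta 3 *
              ∑ y ∈ (zdGraph 3).neighborFinset x, spinAt y σ))) ^ 2) ≤
          C * (#(box 3 r) : ℝ) * (r : ℝ) ^ (-b) *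
            plusExpect 3 (criticalBeta 3) 0 (fun σ => A σ *
              (1 - Real.tanh (criticalBeta 3 *
                ∑ y ∈ (zdGraph 3).neighborFinset 0, spinAt y σ) ^ 2)) ^ 2) :
    ∃ c : ℝ, 0 < c ∧ ∀ n : ℕ, 1 ≤ n →
      c * (n : ℝ) ^ (3 + b) ≤ ∑ x ∈ box 3 n, ∑ y ∈ box 3 n, criticalTwoPoint 3 (y - x) := by
  refine ⟨C⁻¹, inv_pos.2 hC, fun r hr => ?_⟩
  obtain ⟨K, A, hK, hA, hcA, hV⟩ := hW r hr
  -- abbreviations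
  set cA := plusExpect 3 (criticalBeta 3) 0 (fun σ => A σ *
    (1 - Real.tanh (criticalBeta 3 * ∑ y ∈ (zdGraph 3).neighborFinset 0, spinAt y σ) ^ 2)) with hcAdef
  set V := plusExpect 3 (criticalBeta 3) 0 (fun σ => (∑ x ∈ box 3 r, A (fun y => σ (y + x)) *
    (spinAt x σ - Real.tanh (criticalBeta 3 *
      ∑ y ∈ (zdGraph 3).neighborFinset x, spinAt y σ))) ^ 2) with hVdef
  set B := ∑ x ∈ box 3 r, ∑ y ∈ box 3 r, criticalTwoPoint 3 (y - x) with hBdef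
  set Λ : ℝ := (#(box 3 r) : ℝ) with hΛdef
  have hCR : (Λ * cA) ^ 2 ≤ B * V := cramerRaoFloor K A hK hA r
  have hr0 : (0 : ℝ) < r := Nat.cast_pos.2 hr
  have hΛpos : 0 < Λ := by
    rw [hΛdef, card_box]; positivity
  have hB0 : 0 ≤ B := Finset.sum_nonneg fun x _ => Finset.sum_nonneg fun y _ => criticalTwoPoint_nonneg' _
  have hrb : 0 < (r : ℝ) ^ (-b) := Real.rpow_pos_of_pos hr0 _
  -- `(Λ c_A)² ≤ B · C Λ r^{-b} c_A²`, divide by `C Λ r^{-b} c_A² > 0`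
  have hkey : (Λ * cA) ^ 2 ≤ B * (C * Λ * (r : ℝ) ^ (-b) * cA ^ 2) :=
    hCR.trans (mul_le_mul_of_nonneg_left hV hB0)
  have hden : 0 < C * Λ * (r : ℝ) ^ (-b) * cA ^ 2 := by positivity
  have hΛB : Λ * ((r : ℝ) ^ (-b))⁻¹ ≤ C * B := by
    have h1 : Λ ^ 2 * cA ^ 2 ≤ B * C * Λ * (r : ℝ) ^ (-b) * cA ^ 2 := by nlinarith [hkey]
    have h2 : Λ ≤ B * C * (r : ℝ) ^ (-b) := by
      have hpos : 0 < Λ * cA ^ 2 := by positivity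
      nlinarith [h1, hpos]
    calc Λ * ((r : ℝ) ^ (-b))⁻¹ ≤ B * C * (r : ℝ) ^ (-b) * ((r : ℝ) ^ (-b))⁻¹ :=
          mul_le_mul_of_nonneg_right h2 (inv_nonneg.2 hrb.le)
      _ = C * B := by field_simp
  -- `r^{3+b} ≤ Λ · r^{b}`
  have hpow : (r : ℝ) ^ (3 + b) ≤ Λ * ((r : ℝ) ^ (-b))⁻¹ := by
    rw [Real.rpow_add hr0, Real.rpow_neg hr0.le, inv_inv]
    exact mul_le_mul_of_nonneg_right (rpow_three_le_card_box r) (Real.rpow_nonneg hr0.le _)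
  calc C⁻¹ * (r : ℝ) ^ (3 + b) ≤ C⁻¹ * (C * B) :=
        mul_le_mul_of_nonneg_left (hpow.trans hΛB) (inv_nonneg.2 hC.le)
    _ = B := by field_simp

/-- **Transfer, step 2 (the line's certificate): Stein witnesses with `b ∈ (3 − 3L/(2+L), 2]` ⇒ the crux**,
through the landed tree stubs `stub_susceptibilityFloorOfBoxPairFloor` (pair-sum floor `s = 3 + b` ⇒
`χ_n ≥ c n^{b}`) and certificate C1 `stub_cruxOfSusceptibilityFloor` (`a₀ = 3 − b ∈ [1, 3L/(2+L))`). [folklore] -/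
theorem subPtolemyFloor_of_steinWitness {b C : ℝ}
    (hb : 3 - 3 * Real.logb 2 (1 + Real.sqrt 2) / (2 + Real.logb 2 (1 + Real.sqrt 2)) < b)
    (hb2 : b ≤ 2) (hC : 0 < C)
    (hW : ∀ r : ℕ, 1 ≤ r → ∃ (K : Finset (Site 3)) (A : SpinConfig (Site 3) → ℝ),
        (0 : Site 3) ∉ K ∧ DependsOn A (↑K : Set (Site 3)) ∧
        0 < plusExpect 3 (criticalBeta 3) 0 (fun σ => A σ *
            (1 - Real.tanh (criticalBeta 3 * ∑ y ∈ (zdGraph 3).neighborFinset 0, spinAt y σ) ^ 2)) ∧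
        plusExpect 3 (criticalBeta 3) 0 (fun σ => (∑ x ∈ box 3 r, A (fun y => σ (y + x)) *
            (spinAt x σ - Real.tanh (criticalBeta 3 *
              ∑ y ∈ (zdGraph 3).neighborFinset x, spinAt y σ))) ^ 2) ≤
          C * (#(box 3 r) : ℝ) * (r : ℝ) ^ (-b) *
            plusExpect 3 (criticalBeta 3) 0 (fun σ => A σ *
              (1 - Real.tanh (criticalBeta 3 *
                ∑ y ∈ (zdGraph 3).neighborFinset 0, spinAt y σ) ^ 2)) ^ 2) :
    -- (= `SubPtolemyFloor` unfolded; stated by name in the landed certificate, unfolded here so that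
    --  `SubPtolemyFloor_of` is the skeleton's only theorem concluding the crux by name)
    ∃ a c : ℝ, a < Real.logb 2 (1 + Real.sqrt 2) ∧ 0 < c ∧ ∀ n : ℕ, 1 ≤ n →
      c * (n : ℝ) ^ (-a) ≤ criticalTwoPoint 3 ((n : ℤ) • (Pi.single 0 1 : Site 3)) := by
  suffices h : SubPtolemyFloor by exact h
  obtain ⟨c, hc, hB⟩ := boxPairFloor_of_steinWitness hC hW
  have hL := SubPtolemyFloorSketch.ptolemyExp_pos
  have hb0 : (0 : ℝ) ≤ b := by
    have h3 : 3 * Real.logb 2 (1 + Real.sqrt 2) / (2 + Real.logb 2 (1 + Real.sqrt 2)) ≤ 3 := by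
      rw [div_le_iff₀ (by linarith)]; nlinarith
    linarith
  have hs : (3 : ℝ) ≤ 3 + b := by linarith
  obtain ⟨c', hc', hS⟩ := SubPtolemyFloorSketch.stub_susceptibilityFloorOfBoxPairFloor (3 + b) hs ⟨c, hc, hB⟩
  refine SubPtolemyFloorSketch.stub_cruxOfSusceptibilityFloor ⟨3 - b, by linarith, by linarith, c', hc', ?_⟩
  intro n hn
  have h := hS n hn
  have he : (3 : ℝ) - (6 - (3 + b)) = 3 - (3 - b) := by ring
  rw [he] at h
  exact h

/-- **The composition: the crux from the registered stubs** (E + S1 + S2 via the glue above; S3 is a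
tool for E). -/
theorem SubPtolemyFloor_of : SubPtolemyFloor := by
  obtain ⟨b, C, hb, hb2, hC, hW⟩ := stub_steinWitness
  exact subPtolemyFloor_of_steinWitness hb hb2 hC hW

end Summit.CriticalPhenomena.Ising3DConformalLimit.SubPtolemyFloorStein

end
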